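import Summits.ABC.IUTFork.Cor312PilotIdelesPrWitness
import Summits.ABC.IUTFork.Cor312ProvenanceDHWitness
import Literature.IUT.LogVolume.RArithmeticDivisorsPullback
import Literature.IUT.LogVolume.RArithmeticDivisorsBridge
import Literature.IUT.HodgeTheaters.InitialThetaDataBadPlaceOrdProofs
import Literature.IUT.HodgeTheaters.InitialThetaDataQParamRootValuationProofs
import Literature.NumberTheory.EllipticCurves.MultiplicativeReductionJValuationProofs
import HarnessLib

/-!
# [IUTchIII] Cor. 3.12 provenance at the level of `K`: the idele SIDE CONDITIONS of the genuine-setting certificates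
# are INHABITED for Dupuy–Hilado pilot data over `K = F(E_F[l])` lying over `𝕍^bad_mod`, and their `q`-number is
# `|log(q)|` (repair R1: side conditions + `hq`, definition-free)

PROOF-ONLY companion (0 `def`, no new `Prop`; seat abc-iut-s2-p12, R2 S-CHAIN TEAM row «idele side conditions
packaged from c312-3's realising ideles», done at the level where it is TRUE). TAKES NO SIDE on [IUTchIII] Cor. 3.12.

CONTEXT. The genuine-setting certificates (`Conditional.cor312Of_of_SH_genuine` p430884, v4, Shrink2/3) carry the
side conditions `htq0 htq1 htq ht0 ht1` on ideles of abc-iut-c312-7's `settingPrVolSharp X … tq t`, read in the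
rescaled completions of the field of the pilot data `X`; `htq` («`tq` REALISES `P_q`») holds iff `2l ∣ ord_v(q_v)`
on `S` (c312-3 `exists_realising_qIdeles` ⟸; C-cert-3 `SideVacuity.two_mul_l_dvd_ordq_of_realising` p432420 /
w5-d054 `exists_realising_qIdeles_iff` p432578 ⟹). Over the field `F` OF an initial Θ-datum this divisibility
FAILS at every bad place ([IUTchI] Def. 3.1 (c) `InitialThetaData.l_coprime_qParamOrd`), so those certificates are
vacuous as typed (C-lead ruling C-R16). Print works over `K = F(E_F[l])` ([IUTchI] Def. 3.1 (c), (e); Ex. 3.2 (iv)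
p. 71: `q̲_v = q_v^{1/2l} ∈ K_v̲`), where the divisibility HOLDS: abc-iut-L5-t2 / w5-d158
`InitialThetaData.two_mul_l_dvd_ordMinimalDiscriminant` (every prime of `K` over `𝕍^bad_mod`) and
`InitialThetaData.two_mul_dvd_ordMinimalDiscriminant_baseChange` (every prime of `K` over `𝕍(F)^bad`).

THIS FILE (definition-free, so that it composes with ANY `K`-level provenance structure — C-R16 (b)'s
`IsPilotDataOfK`, owner abc-iut-C-cert-3 — by field projection): for pilot data `X : PilotData K` with `X.l = l`
whose bad set `S` lies over `𝕍^bad_mod` (equivalently over `𝕍(F)^bad`) and whose `ord_w(q_w)` is the Tate order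
`qParamOrd (E_F ⊗ K) w = ord_w(Δ_min(E_K))`:
* `KSide.ordq_eq_qParamOrd_baseChange` — the `ord` field is AUTOMATIC when `j_X = j(E_F)` read in `K`
  (`ord_w(q_w) := −ord_w(j) = ord_w(Δ_min(E_K))` at a multiplicative `w`, Silverman AEC VII.5.1 in the tree);
* `KSide.two_mul_l_dvd_ordq` / `…_of_over_VFbad` — `2l ∣ ord_w(q_w)` at every `w ∈ S` (c312-3's `hdiv`);
* **`KSide.exists_sideConditions`** / `…_of_over_VFbad` — there EXIST Θ-ideles `t` and `q`-ideles `tq` in the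
  rescaled completions `K_w` meeting ALL SIX conditions `ht0 ∧ ht1 ∧ ht ∧ htq0 ∧ htq1 ∧ htq` (non-zero; units
  off `S`; REALISING `P_Θ`, `P_q` in Dupuy–Hilado's normalisation (3.4)) — abc-iut-c312-3
  `exists_realising_thetaIdeles` / `exists_realising_qIdeles` + `norm_eq_one_of_realises` /
  c312-7 `qIdele_norm_eq_one_of_realises`, BY NAME;
* `KSide.exists_ideles_settingPrVolSharp` — hence abc-iut-c312-7's whole non-vacuity bundle
  `exists_ideles_settingPrVolSharp` (ThetaFinite, BridgeHyps, ThetaRegionsAdm, `−|log(q)| = −deĝ(P_q)`,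
  `|log(q)| > 0`, `Statement ↔ …`) holds at such `K`-level pilot data for every choice of the free context binders;
* §4, the `q`-NUMBER over `K` (the READ binder `hq` of a `K`-level certificate): `KSide.qParamOrd_baseChange_eq_mul`
  (`ord_w(Δ_min(E_K)) = e(w|v)·ord_v(Δ_min(E_F))`, abc-iut-c312-4's identity indexed by `𝕍(F)^bad`),
  `KSide.ofFinDivisor_qPilot_eq_pullback` (`P_q^K` = the pull-back of the datum's own `P_q^F`, [IUTchIV] Def. 1.9 (i)),
  **`KSide.ndeg_qPilot_eq_absLogq`** / `…_of_tateOrd` (`deĝ̲_K(P_q^K) = |log(q)|`, by `ndeg_pullback` + c312-8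
  `absLogq_eq_ndeg_qPilot_pilotDataOfF` — [IUTchIV] Thm. 1.10 p. 23 «independent of the choice of `F□`») and
  `KSide.negLogQ_settingPrVolSharp_eq_neg_absLogq` (c312-7's `−|log(q)| = −deĝ_K(P_q)` at REALISING `tq`, now
  satisfiable, composed: the setting's `−|log(q)|` IS `−(1/2l)·log(q)` of the datum) — for `S` = ALL primes of
  `𝓞_K` over `𝕍(F)^bad` (the pull-back needs every prime above, not only the section `V̲`).
So the non-vacuity witness that C-R16 (b) asks for before `abc_of_S_v5` files, and the `K`-level `hq`, are available
BY NAME for any `IsPilotDataOfK` whose fields give `X.l = l`, `S` = the primes over `𝕍(F)^bad`, and the Tate (or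
pulled-back) orders. Nothing of c312-3 / c312-4 / c312-7 / c312-8 / L5 is restated or edited. [cite: Mochizuki2012, IUTchI Def. 3.1 (c)(e) pp. 61–62; Ex. 3.2 (iv) p. 71]
[cite: DupuyHilado2025, §3.3, §3.4] [claim: Mochizuki2012, status: disputed] for every IUT quotation.
HONEST FRAMING: an existence statement about OUR binders over `K`; nothing here bears on `−|log(Θ)|` versus
`−|log(q)|`, on Cor. 3.12, or on abc; typed ≠ proved; instantiated ≠ endorsed.
-/

noncomputable section

open Set Function NumberField IsDedekindDomain WeierstrassCurve

namespace Summit.ABC.IUTFork.Cor312Prov.KSide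

open Literature.IUT.HodgeTheaters Literature.IUT.LogVolume Literature.IUT.LogThetaLattice Thm311 Thm311.Real Cor312 Cor312Vol

variable {F K Fbar : Type} [Field F] [NumberField F] [Field K] [NumberField K] [Algebra F K] [Field Fbar]
  [Algebra F Fbar] [Algebra K Fbar] {E : WeierstrassCurve F} [E.IsElliptic] {l : ℕ} {Pb : BadPlacePredicates K}
  (D : InitialThetaData F K Fbar E l Pb) (X : PilotData K)

/-! ## §1. The Tate order over `K` and the divisibility `2l ∣ ord_w(q_w)` -/

/-- **`E_F ⊗ K` has multiplicative reduction at every prime `w` of `K` over `𝕍^bad_mod`** ([IUTchI] Def. 3.1 (b)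
read over `K`): multiplicative below `w` (L5-t2 `hasMultiplicativeReductionAt_under_of_over_VbadMod`), `w ∤ l`,
and `Γ_K` fixes `E_K[l]` (`smul_geomTorsion_l_eq`), through the tree's Silverman VII.5.1/VII.6.1 engine.
[cite: Mochizuki2012, IUTchI Def. 3.1 (b)(c) pp. 61–62] -/
theorem hasMultiplicativeReductionAt_baseChange {w : HeightOneSpectrum (𝓞 K)}
    (hw : toVMod F K E (Val.non (FinitePlace.mk w)) ∈ Val.non '' D.VbadMod) :
    (E.baseChange K).HasMultiplicativeReductionAt w := by
  haveI : w.asIdeal.LiesOver (w.under (𝓞 F)).asIdeal := ⟨rfl⟩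
  exact E.hasMultiplicativeReductionAt_baseChange_of_forall_smul_geomTorsion_eq
    (D.hasMultiplicativeReductionAt_under_of_over_VbadMod w hw) D.l_prime (by have := D.five_le_l; omega)
    (D.l_notMem_of_over_VbadMod w hw) D.smul_geomTorsion_l_eq

/-- **The `ord` field is automatic**: for pilot data over `K` whose `j`-invariant is `j(E_F)` read in `K`, at every
prime `w` of `K` over `𝕍^bad_mod`, Dupuy–Hilado's `ord_w(q_w) := −ord_w(j_E)` (c312-3 `PilotData.ordq`) equals the
Tate order `qParamOrd (E_F ⊗ K) w := ord_w(Δ_min(E_K))` (the tree's Silverman VII.5.1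
`log_valuation_j_eq_ordMinimalDiscriminant_of_hasMultiplicativeReductionAt`, over `K`).
[cite: DupuyHilado2025, §3.2–3.3] -/
theorem ordq_eq_qParamOrd_baseChange (hj : X.jE = algebraMap F K E.j) {w : HeightOneSpectrum (𝓞 K)}
    (hw : toVMod F K E (Val.non (FinitePlace.mk w)) ∈ Val.non '' D.VbadMod) :
    X.ordq w = (qParamOrd (E.baseChange K) w : ℤ) := by
  haveI : (E.baseChange K).IsElliptic := by unfold WeierstrassCurve.baseChange; infer_instance
  have hwm := hasMultiplicativeReductionAt_baseChange D hw
  have hjK : (E.baseChange K).j = algebraMap F K E.j := by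
    unfold WeierstrassCurve.baseChange
    exact E.map_j _
  unfold PilotData.ordq ord qParamOrd
  rw [hj, ← hjK, neg_neg]
  exact (E.baseChange K).log_valuation_j_eq_ordMinimalDiscriminant_of_hasMultiplicativeReductionAt w hwm

/-- **`2l ∣ ord_w(q_w)` at every `w ∈ S`** — abc-iut-c312-3's divisibility `hdiv`, HOLDING for `K`-level pilot
data whose `S` lies over `𝕍^bad_mod` and whose orders are the Tate orders ([IUTchI] Ex. 3.2 (iv), valuation half:
L5-t2 `InitialThetaData.two_mul_l_dvd_ordMinimalDiscriminant`). [cite: Mochizuki2012, IUTchI Ex. 3.2 (iv) p. 71] -/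
theorem two_mul_l_dvd_ordq (hl : X.l = l)
    (hS : ∀ w ∈ X.S, toVMod F K E (Val.non (FinitePlace.mk w)) ∈ Val.non '' D.VbadMod)
    (hord : ∀ w ∈ X.S, X.ordq w = (qParamOrd (E.baseChange K) w : ℤ)) :
    ∀ w ∈ X.S, (2 * X.l : ℤ) ∣ X.ordq w := by
  intro w hw
  rw [hl, hord w hw]
  exact_mod_cast D.two_mul_l_dvd_ordMinimalDiscriminant w (hS w hw)

/-- The same with `S` indexed over `𝕍(F)^bad` (the shape «`S` = the primes of `𝓞_K` over `𝕍(F)^bad`» of C-R16 (b)):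
`2l ∣ ord_w(q_w)` at every `w ∈ S` lying over some `x ∈ 𝕍(F)^bad` (w5-d158
`InitialThetaData.two_mul_dvd_ordMinimalDiscriminant_baseChange`). [cite: Mochizuki2012, IUTchI Ex. 3.2 (iv) p. 71] -/
theorem two_mul_l_dvd_ordq_of_over_VFbad (hl : X.l = l)
    (hS : ∀ w ∈ X.S, ∃ x ∈ D.VFbad, w.asIdeal.LiesOver x.maximalIdeal.asIdeal)
    (hord : ∀ w ∈ X.S, X.ordq w = (qParamOrd (E.baseChange K) w : ℤ)) :
    ∀ w ∈ X.S, (2 * X.l : ℤ) ∣ X.ordq w := by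
  intro w hw
  obtain ⟨x, hx, hlo⟩ := hS w hw
  haveI := hlo
  rw [hl, hord w hw]
  exact_mod_cast D.two_mul_dvd_ordMinimalDiscriminant_baseChange hx w

/-- The `ord` field over `𝕍(F)^bad`: `ord_w(q_w) = qParamOrd (E_F ⊗ K) w` for `j_X = j(E_F)` at every `w` over some
`x ∈ 𝕍(F)^bad` (multiplicative reduction of `E_K` there: w5-d158 `InitialThetaData.hasMultiplicativeReductionAt_baseChange`).
[cite: DupuyHilado2025, §3.2–3.3] -/
theorem ordq_eq_qParamOrd_baseChange_of_over_VFbad (hj : X.jE = algebraMap F K E.j) {w : HeightOneSpectrum (𝓞 K)}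
    {x : FinitePlace F} (hx : x ∈ D.VFbad) [w.asIdeal.LiesOver x.maximalIdeal.asIdeal] :
    X.ordq w = (qParamOrd (E.baseChange K) w : ℤ) := by
  haveI : (E.baseChange K).IsElliptic := by unfold WeierstrassCurve.baseChange; infer_instance
  have hwm := D.hasMultiplicativeReductionAt_baseChange hx w
  have hjK : (E.baseChange K).j = algebraMap F K E.j := by
    unfold WeierstrassCurve.baseChange
    exact E.map_j _
  unfold PilotData.ordq ord qParamOrd
  rw [hj, ← hjK, neg_neg]
  exact (E.baseChange K).log_valuation_j_eq_ordMinimalDiscriminant_of_hasMultiplicativeReductionAt w hwm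

/-! ## §2. The six side conditions are INHABITED over `K` -/

/-- **The idele side conditions of the genuine-setting certificates are inhabited at `K`-level pilot data over
`𝕍^bad_mod`**: there exist Θ-ideles `t` and `q`-ideles `tq` in the rescaled completions `K_w` with `t ≠ 0`, `‖t‖ = 1`
off `S`, `log ‖t_{j,w}‖ = −P_{Θ,j}(w)·ln|κ(w)|/n_w` (REALISING `P_Θ`), `tq ≠ 0`, `‖tq‖ = 1` off `S`,
`log ‖t_{q,w}‖ = −P_q(w)·ln|κ(w)|/n_w` (REALISING `P_q`, Dupuy–Hilado (3.4)) — abc-iut-c312-3's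
`exists_realising_thetaIdeles` / `exists_realising_qIdeles` at the divisibility of §1, units off `S` by
`norm_eq_one_of_realises` / `qIdele_norm_eq_one_of_realises`. [cite: DupuyHilado2025, §3.3, §3.4] -/
theorem exists_sideConditions (hl : X.l = l)
    (hS : ∀ w ∈ X.S, toVMod F K E (Val.non (FinitePlace.mk w)) ∈ Val.non '' D.VbadMod)
    (hord : ∀ w ∈ X.S, X.ordq w = (qParamOrd (E.baseChange K) w : ℤ)) :
    ∃ (t : ∀ (pp : Nat.Primes) (_ : Fin X.lstar) (x : (thetaIndex X).Fibre (.inr pp)),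
          haveI : Fact (pp : ℕ).Prime := ⟨pp.2⟩; kOf X pp.1 x)
      (tq : ∀ (pp : Nat.Primes) (x : (thetaIndex X).Fibre (.inr pp)), haveI : Fact (pp : ℕ).Prime := ⟨pp.2⟩; kOf X pp.1 x),
      (∀ pp i x, t pp i x ≠ 0) ∧
      (∀ (pp : Nat.Primes) (i : Fin X.lstar) (x : (thetaIndex X).Fibre (.inr pp)),
          haveI : Fact (pp : ℕ).Prime := ⟨pp.2⟩; placeOf X pp.1 x ∉ X.S → ‖t pp i x‖ = 1) ∧
      (∀ (pp : Nat.Primes) (i : Fin X.lstar) (x : (thetaIndex X).Fibre (.inr pp)),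
          haveI : Fact (pp : ℕ).Prime := ⟨pp.2⟩
          Real.log ‖t pp i x‖ = -(X.thetaPilot i (placeOf X pp.1 x)) * logNorm K (placeOf X pp.1 x) /
            localDegree K (placeOf X pp.1 x)) ∧
      (∀ pp x, tq pp x ≠ 0) ∧
      (∀ (pp : Nat.Primes) (x : (thetaIndex X).Fibre (.inr pp)),
          haveI : Fact (pp : ℕ).Prime := ⟨pp.2⟩; placeOf X pp.1 x ∉ X.S → ‖tq pp x‖ = 1) ∧
      (∀ (pp : Nat.Primes) (x : (thetaIndex X).Fibre (.inr pp)),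
          haveI : Fact (pp : ℕ).Prime := ⟨pp.2⟩
          Real.log ‖tq pp x‖ = -(X.qPilot (placeOf X pp.1 x)) * logNorm K (placeOf X pp.1 x) /
            localDegree K (placeOf X pp.1 x)) := by
  have hdiv := two_mul_l_dvd_ordq D X hl hS hord
  obtain ⟨t, ht0, ht⟩ := exists_realising_thetaIdeles X hdiv
  obtain ⟨tq, htq0, htq⟩ := exists_realising_qIdeles X hdiv
  exact ⟨t, tq, ht0, fun pp i x hx => norm_eq_one_of_realises X t ht0 ht pp i x hx, ht, htq0,
    fun pp x hx => qIdele_norm_eq_one_of_realises X tq htq0 htq pp x hx, htq⟩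

/-- The same with `S` indexed over `𝕍(F)^bad`. [cite: DupuyHilado2025, §3.3, §3.4] -/
theorem exists_sideConditions_of_over_VFbad (hl : X.l = l)
    (hS : ∀ w ∈ X.S, ∃ x ∈ D.VFbad, w.asIdeal.LiesOver x.maximalIdeal.asIdeal)
    (hord : ∀ w ∈ X.S, X.ordq w = (qParamOrd (E.baseChange K) w : ℤ)) :
    ∃ (t : ∀ (pp : Nat.Primes) (_ : Fin X.lstar) (x : (thetaIndex X).Fibre (.inr pp)),
          haveI : Fact (pp : ℕ).Prime := ⟨pp.2⟩; kOf X pp.1 x)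
      (tq : ∀ (pp : Nat.Primes) (x : (thetaIndex X).Fibre (.inr pp)), haveI : Fact (pp : ℕ).Prime := ⟨pp.2⟩; kOf X pp.1 x),
      (∀ pp i x, t pp i x ≠ 0) ∧
      (∀ (pp : Nat.Primes) (i : Fin X.lstar) (x : (thetaIndex X).Fibre (.inr pp)),
          haveI : Fact (pp : ℕ).Prime := ⟨pp.2⟩; placeOf X pp.1 x ∉ X.S → ‖t pp i x‖ = 1) ∧
      (∀ (pp : Nat.Primes) (i : Fin X.lstar) (x : (thetaIndex X).Fibre (.inr pp)),
          haveI : Fact (pp : ℕ).Prime := ⟨pp.2⟩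
          Real.log ‖t pp i x‖ = -(X.thetaPilot i (placeOf X pp.1 x)) * logNorm K (placeOf X pp.1 x) /
            localDegree K (placeOf X pp.1 x)) ∧
      (∀ pp x, tq pp x ≠ 0) ∧
      (∀ (pp : Nat.Primes) (x : (thetaIndex X).Fibre (.inr pp)),
          haveI : Fact (pp : ℕ).Prime := ⟨pp.2⟩; placeOf X pp.1 x ∉ X.S → ‖tq pp x‖ = 1) ∧
      (∀ (pp : Nat.Primes) (x : (thetaIndex X).Fibre (.inr pp)),
          haveI : Fact (pp : ℕ).Prime := ⟨pp.2⟩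
          Real.log ‖tq pp x‖ = -(X.qPilot (placeOf X pp.1 x)) * logNorm K (placeOf X pp.1 x) /
            localDegree K (placeOf X pp.1 x)) := by
  have hdiv := two_mul_l_dvd_ordq_of_over_VFbad D X hl hS hord
  obtain ⟨t, ht0, ht⟩ := exists_realising_thetaIdeles X hdiv
  obtain ⟨tq, htq0, htq⟩ := exists_realising_qIdeles X hdiv
  exact ⟨t, tq, ht0, fun pp i x hx => norm_eq_one_of_realises X t ht0 ht pp i x hx, ht, htq0,
    fun pp x hx => qIdele_norm_eq_one_of_realises X tq htq0 htq pp x hx, htq⟩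

/-! ## §3. abc-iut-c312-7's non-vacuity bundle at `K`-level pilot data -/

variable {logv : PadicLogs K} (hlog : LogvAnalytic logv) (M : Type) [Field M] [NumberField M]
  (archPk : ∀ (j : (thetaIndex X).Label) (vQ : (thetaIndex X).VQ), Set ((logShellsDH X logv).Packet j vQ))
  (archSub : ∀ (j : (thetaIndex X).Label) (v : (thetaIndex X).V),
    Set ((logShellsDH X logv).Packet j ((thetaIndex X).over v)))
  (Ψ : ℤ → ∀ v : (thetaIndex X).V, v ∈ (thetaIndex X).Vbad → Set ((logShellsDH X logv).StarPacket v))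
  (act : ℤ → ∀ v : (thetaIndex X).V, v ∈ (thetaIndex X).Vbad →
    (logShellsDH X logv).StarPacket v → Module.End ℚ ((logShellsDH X logv).StarPacket v))
  (Mmod : ℤ → ∀ j : (thetaIndex X).LabelStar, Set ((logShellsDH X logv).GlobalPacket j.1))
  (region : ℤ → ∀ j : (thetaIndex X).LabelStar, FinDivisor M → ∀ vQ : (thetaIndex X).VQ,
    Set ((logShellsDH X logv).Packet j.1 vQ))
  (n : ℤ) {HT : Type} {LogLink : HT → HT → Type} {IsFull : ∀ {s t : HT}, LogLink s t → Prop}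
  (lat : LGPGaussianLogThetaLattice LogLink IsFull)
  {Frd : Type} {IsoF : Frd → Frd → Type} {Ob : Frd → Type} {realify : Frd → Frd} {Strip : Type}
  {IsoS : Strip → Strip → Type} {Mv : ∀ v : (thetaIndex X).V, v ∈ (thetaIndex X).Vbad → Type}
  [∀ v h, Monoid (Mv v h)]
  (sig : GlobalLGPFrobenioidSignature (thetaIndex X).lstar (thetaIndex X).V (· ∈ (thetaIndex X).Vbad)
    Frd IsoF Ob realify Strip IsoS Mv)
  (split : SplittingMonoids Mv) {ObΔ : Type} {N : ∀ v : (thetaIndex X).V, v ∈ (thetaIndex X).Vbad → Type}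
  [∀ v h, Monoid (N v h)] (qData : QPilotData ObΔ N)

/-- **abc-iut-c312-7's `exists_ideles_settingPrVolSharp` AT `K`-LEVEL PILOT DATA over `𝕍^bad_mod`**: realising
ideles exist (§1–§2), so for the print-normalised assembled real setting over `K` with the pilot regions read off
THEM all of c312-7's conclusions hold at once — "`−|log(Θ)| ∈ ℝ`", `BridgeHyps`, `ThetaRegionsAdm`,
`−|log(q)| = −deĝ_K(P_q)`, "`|log(q)| > 0`", and `Statement ↔ ↑(−deĝ_K(P_q)) ≤ −|log(Θ)|` — for every analytic
logarithm family and every choice of the free context binders. [claim: Mochizuki2012, status: disputed] -/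
theorem exists_ideles_settingPrVolSharp (hl : X.l = l)
    (hS : ∀ w ∈ X.S, toVMod F K E (Val.non (FinitePlace.mk w)) ∈ Val.non '' D.VbadMod)
    (hord : ∀ w ∈ X.S, X.ordq w = (qParamOrd (E.baseChange K) w : ℤ)) :
    ∃ (t : ∀ (pp : Nat.Primes) (_ : Fin X.lstar) (x : (thetaIndex X).Fibre (.inr pp)),
          haveI : Fact (pp : ℕ).Prime := ⟨pp.2⟩; kOf X pp.1 x)
      (tq : ∀ (pp : Nat.Primes) (x : (thetaIndex X).Fibre (.inr pp)), haveI : Fact (pp : ℕ).Prime := ⟨pp.2⟩; kOf X pp.1 x)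
      (_ : ∀ pp i x, t pp i x ≠ 0)
      (_ : ∀ (pp : Nat.Primes) (i : Fin X.lstar) (x : (thetaIndex X).Fibre (.inr pp)),
          haveI : Fact (pp : ℕ).Prime := ⟨pp.2⟩
          Real.log ‖t pp i x‖ = -(X.thetaPilot i (placeOf X pp.1 x)) * logNorm K (placeOf X pp.1 x) /
            localDegree K (placeOf X pp.1 x))
      (htq0 : ∀ pp x, tq pp x ≠ 0)
      (htq1 : ∀ (pp : Nat.Primes) (x : (thetaIndex X).Fibre (.inr pp)),
          haveI : Fact (pp : ℕ).Prime := ⟨pp.2⟩; placeOf X pp.1 x ∉ X.S → ‖tq pp x‖ = 1)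
      (_ : ∀ (pp : Nat.Primes) (x : (thetaIndex X).Fibre (.inr pp)),
          haveI : Fact (pp : ℕ).Prime := ⟨pp.2⟩
          Real.log ‖tq pp x‖ = -(X.qPilot (placeOf X pp.1 x)) * logNorm K (placeOf X pp.1 x) /
            localDegree K (placeOf X pp.1 x)),
      (settingPrVolSharp X hlog M archPk archSub Ψ act Mmod region n lat sig split qData tq t htq0 htq1).ThetaFinite ∧
      BridgeHyps (settingPrVolSharp X hlog M archPk archSub Ψ act Mmod region n lat sig split qData tq t htq0 htq1) ∧
      ThetaRegionsAdm (settingPrVolSharp X hlog M archPk archSub Ψ act Mmod region n lat sig split qData tq t htq0 htq1) ∧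
      (settingPrVolSharp X hlog M archPk archSub Ψ act Mmod region n lat sig split qData tq t htq0 htq1).negLogQ =
          -FinDivisor.ndeg K X.qPilot ∧
      (settingPrVolSharp X hlog M archPk archSub Ψ act Mmod region n lat sig split qData tq t htq0 htq1).AbsLogQPos ∧
      ((settingPrVolSharp X hlog M archPk archSub Ψ act Mmod region n lat sig split qData tq t htq0 htq1).Statement ↔
        (((-FinDivisor.ndeg K X.qPilot : ℝ) : WithTop ℝ) ≤
          (settingPrVolSharp X hlog M archPk archSub Ψ act Mmod region n lat sig split qData tq t htq0 htq1).negLogTheta)) :=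
  Thm311.Real.exists_ideles_settingPrVolSharp X hlog M archPk archSub Ψ act Mmod region n lat sig split qData
    (two_mul_l_dvd_ordq D X hl hS hord)

/-! ## §4. The `q`-number over `K`: `deĝ̲_K(P_q) = |log(q)|` — the READ binder `hq` at `K`-level pilot data -/

/-- **`ord_w(Δ_min(E_K)) = e(w|v)·ord_v(Δ_min(E_F))`** for a prime `w` of `K` over `v = w ∩ 𝓞_F ∈ 𝕍(F)^bad`: both sides are
`−ord(j)` at a multiplicative place (the tree's Silverman VII.5.1 `valuation_j_eq_exp_ordMinimalDiscriminant_of_…`),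
`j(E_K) = j(E_F)`, and `|x|_w = |x|_v^{e(w|v)}` (Mathlib `valuation_liesOver`) — abc-iut-c312-4's `qParamOrd_baseChange_eq_mul`,
here indexed by `𝕍(F)^bad` through `finBelow`. [cite: DupuyHilado2025, §2.4.2, §3.3] -/
theorem qParamOrd_baseChange_eq_mul {w : HeightOneSpectrum (𝓞 K)} (hx : FinitePlace.mk (finBelow F K w) ∈ D.VFbad) :
    (qParamOrd (E.baseChange K) w : ℤ) =
      ((finBelow F K w).asIdeal.ramificationIdx' w.asIdeal : ℤ) * qParamOrd E (finBelow F K w) := by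
  haveI : (E.baseChange K).IsElliptic := by unfold WeierstrassCurve.baseChange; infer_instance
  haveI hlo : w.asIdeal.LiesOver (FinitePlace.mk (finBelow F K w)).maximalIdeal.asIdeal := by
    rw [FinitePlace.maximalIdeal_mk]; exact liesOver_finBelow F K w
  have hv : E.HasMultiplicativeReductionAt (finBelow F K w) := by
    have h := D.multiplicative_over_VbadMod (FinitePlace.mk (finBelow F K w)) hx
    rwa [FinitePlace.maximalIdeal_mk] at h
  have hwm : (E.baseChange K).HasMultiplicativeReductionAt w := D.hasMultiplicativeReductionAt_baseChange hx w
  have hj : (E.baseChange K).j = algebraMap F K E.j := by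
    unfold WeierstrassCurve.baseChange
    exact E.map_j _
  have h := IsDedekindDomain.HeightOneSpectrum.valuation_liesOver K (finBelow F K w) w E.j
  rw [E.valuation_j_eq_exp_ordMinimalDiscriminant_of_hasMultiplicativeReductionAt (finBelow F K w) hv, ← hj,
    (E.baseChange K).valuation_j_eq_exp_ordMinimalDiscriminant_of_hasMultiplicativeReductionAt w hwm,
    ← WithZero.exp_nsmul, Int.nsmul_eq_mul, WithZero.exp_inj] at h
  unfold qParamOrd
  exact_mod_cast h.symm

/-- **`P_q` over `K` is the pull-back of `P_q` over `F`** ([IUTchIV] Def. 1.9 (i): `𝔞|_K = Σ_w e(w|v)·c_{v(w)}·w`): for pilot data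
over `K` with the prime `l`, `S` = the primes of `𝓞_K` over `𝕍(F)^bad` and orders `ord_w(q_w) = e(w|v)·ord_v(q_v)`, the `ℝ`-arithmetic
divisor of `P_q^K` is the pull-back of that of the datum's OWN `P_q` (c312-8's `pilotDataOfF D`), coefficientwise
`e·ord_v(q_v)/(2l) = e·(ord_v(q_v)/(2l))`. [cite: Mochizuki2012, IUTchIV Def. 1.9 (i) p. 22] -/
theorem ofFinDivisor_qPilot_eq_pullback (hl : X.l = l)
    (hS : ∀ w : HeightOneSpectrum (𝓞 K), w ∈ X.S ↔ FinitePlace.mk (finBelow F K w) ∈ D.VFbad)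
    (horde : ∀ w ∈ X.S, X.ordq w = ((finBelow F K w).asIdeal.ramificationIdx' w.asIdeal : ℤ) * qParamOrd E (finBelow F K w)) :
    ADivisor.ofFinDivisor K X.qPilot = (ADivisor.ofFinDivisor F (pilotDataOfF D).qPilot).pullback F K := by
  ext w
  rcases w with w | w
  · rw [ADivisor.ofFinDivisor_apply_inl, ADivisor.pullback_apply]
    change (0 : ℝ) = _ * ADivisor.ofFinDivisor F (pilotDataOfF D).qPilot (Sum.inl (w.comap (algebraMap F K)))
    rw [ADivisor.ofFinDivisor_apply_inl, mul_zero]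
  · rw [ADivisor.pullback_apply]
    change ADivisor.ofFinDivisor K X.qPilot (Sum.inr w) =
      _ * ADivisor.ofFinDivisor F (pilotDataOfF D).qPilot (Sum.inr (finBelow F K w))
    rw [ADivisor.ofFinDivisor_apply_inr, ADivisor.ofFinDivisor_apply_inr]
    have he : (pullbackWeight F K (Sum.inr w) : ℝ) = ((finBelow F K w).asIdeal.ramificationIdx' w.asIdeal : ℝ) := rfl
    by_cases hw : w ∈ X.S
    · have hv : finBelow F K w ∈ (pilotDataOfF D).S := (mem_pilotDataOfF_S_iff D _).mpr ((hS w).mp hw)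
      have hordF : (pilotDataOfF D).ordq (finBelow F K w) = (qParamOrd E (finBelow F K w) : ℤ) := by
        have h := (isPilotDataOf_pilotDataOfF D).ordq_eq (FinitePlace.mk (finBelow F K w)) ((hS w).mp hw)
        rwa [FinitePlace.maximalIdeal_mk] at h
      rw [X.qPilot_apply_of_mem hw, (pilotDataOfF D).qPilot_apply_of_mem hv, he, horde w hw, hl, pilotDataOfF_l, hordF]
      push_cast
      ring
    · have hv : finBelow F K w ∉ (pilotDataOfF D).S := fun h => hw ((hS w).mpr ((mem_pilotDataOfF_S_iff D _).mp h))
      rw [X.qPilot_apply_of_not_mem hw, (pilotDataOfF D).qPilot_apply_of_not_mem hv, mul_zero]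

/-- **`deĝ̲_K(P_q^K) = |log(q)| = (1/2l)·log(q)` of the datum** ([IUTchIV] Thm. 1.10 p. 23 «the various `log(q_{(−)})`'s are
independent of the choice of `F□`»): pull-back invariance of the normalised degree (`ndeg_pullback`, Def. 1.9 (i)) and c312-8's
`|log(q)| = deĝ̲_F(P_q)` at the datum's own pilot data (`absLogq_eq_ndeg_qPilot_pilotDataOfF`). This is the `q`-side READ binder
`hq` of the `K`-level certificate, DISCHARGED for every pilot datum over `K` with `S` over `𝕍(F)^bad` and the pulled-back orders.
[cite: Mochizuki2012, IUTchIV Thm. 1.10 p. 23] -/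
theorem ndeg_qPilot_eq_absLogq (hl : X.l = l)
    (hS : ∀ w : HeightOneSpectrum (𝓞 K), w ∈ X.S ↔ FinitePlace.mk (finBelow F K w) ∈ D.VFbad)
    (horde : ∀ w ∈ X.S, X.ordq w = ((finBelow F K w).asIdeal.ramificationIdx' w.asIdeal : ℤ) * qParamOrd E (finBelow F K w)) :
    FinDivisor.ndeg K X.qPilot = absLogq D := by
  rw [absLogq_eq_ndeg_qPilot_pilotDataOfF D, ← ndeg_ofFinDivisor, ← ndeg_ofFinDivisor,
    ofFinDivisor_qPilot_eq_pullback D X hl hS horde, ndeg_pullback]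

/-- The same with the orders given as the TATE orders over `K` (`ord_w(q_w) = ord_w(Δ_min(E_K))`, the intrinsic form; converted
by `qParamOrd_baseChange_eq_mul`). [cite: Mochizuki2012, IUTchIV Thm. 1.10 p. 23] -/
theorem ndeg_qPilot_eq_absLogq_of_tateOrd (hl : X.l = l)
    (hS : ∀ w : HeightOneSpectrum (𝓞 K), w ∈ X.S ↔ FinitePlace.mk (finBelow F K w) ∈ D.VFbad)
    (hord : ∀ w ∈ X.S, X.ordq w = (qParamOrd (E.baseChange K) w : ℤ)) :
    FinDivisor.ndeg K X.qPilot = absLogq D :=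
  ndeg_qPilot_eq_absLogq D X hl hS fun w hw => by rw [hord w hw, qParamOrd_baseChange_eq_mul D ((hS w).mp hw)]

/-- **`−|log(q)|` of the print-normalised assembled real setting over `K` IS `−(1/2l)·log(q)` of the datum**: abc-iut-c312-7's
`negLogQ_settingPrVolSharp` (`= −deĝ_K(P_q)` when `tq` REALISES `P_q` — satisfiable over `K`, §2) composed with §4's degree identity.
The `q`-side reading at the `K`-level genuine setting, discharged. [cite: Mochizuki2012, IUTchIV Thm. 1.10 p. 23] -/
theorem negLogQ_settingPrVolSharp_eq_neg_absLogq (hl : X.l = l)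
    (hS : ∀ w : HeightOneSpectrum (𝓞 K), w ∈ X.S ↔ FinitePlace.mk (finBelow F K w) ∈ D.VFbad)
    (hord : ∀ w ∈ X.S, X.ordq w = (qParamOrd (E.baseChange K) w : ℤ))
    (t : ∀ (pp : Nat.Primes) (_ : Fin X.lstar) (x : (thetaIndex X).Fibre (.inr pp)),
      haveI : Fact (pp : ℕ).Prime := ⟨pp.2⟩; kOf X pp.1 x)
    (tq : ∀ (pp : Nat.Primes) (x : (thetaIndex X).Fibre (.inr pp)), haveI : Fact (pp : ℕ).Prime := ⟨pp.2⟩; kOf X pp.1 x)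
    (htq0 : ∀ pp x, tq pp x ≠ 0)
    (htq1 : ∀ (pp : Nat.Primes) (x : (thetaIndex X).Fibre (.inr pp)),
      haveI : Fact (pp : ℕ).Prime := ⟨pp.2⟩; placeOf X pp.1 x ∉ X.S → ‖tq pp x‖ = 1)
    (htq : ∀ (pp : Nat.Primes) (x : (thetaIndex X).Fibre (.inr pp)),
      haveI : Fact (pp : ℕ).Prime := ⟨pp.2⟩
      Real.log ‖tq pp x‖ = -(X.qPilot (placeOf X pp.1 x)) * logNorm K (placeOf X pp.1 x) / localDegree K (placeOf X pp.1 x)) :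
    (settingPrVolSharp X hlog M archPk archSub Ψ act Mmod region n lat sig split qData tq t htq0 htq1).negLogQ = -absLogq D := by
  rw [negLogQ_settingPrVolSharp X hlog M archPk archSub Ψ act Mmod region n lat sig split qData t tq htq0 htq1 htq,
    ndeg_qPilot_eq_absLogq_of_tateOrd D X hl hS hord]

end Summit.ABC.IUTFork.Cor312Prov.KSide

end
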